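import Literature.Probability.LatticeModels.RCRepresentation
import Literature.Probability.LatticeModels.RCShift
import Literature.Probability.LatticeModels.PSStabilityInduction
import HarnessLib

/-!
# Random-cluster contours, XI: the two-phase contour model of the random-cluster model and its Pirogov–Sinai output

Topic `Literature/Probability/LatticeModels`. The random-cluster model on `ℤ^d` (in the variables
`t = (p/(1-p))^{1/2}`, `q`) as an instance `rcModel` of the abstract two-phase contour models of `PSStability`:
contours = well-formed thick contours (`rcSetup`), local weights `ρ(γ) = t^{e(γ)} q^{cwt(γ)} / w_{type γ}^{|γ̄|}`,
ground weights `w_ord = t^{2d}`, `w_dis = q` per site, partition functions `Zrc`. All hypotheses of the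
Pirogov–Sinai engine `PSStabilityInduction` are discharged:

* `rcModel_rec` — the external-contour representation `Rec` (from `Zrc_eq_sum_extFam`, `RCRepresentation`);
* `rho_le_exp` — the Peierls bound `ρ(γ) ≤ e^{-τ(q)|γ̄|}` in the window `|2d log t - log q| ≤ 1` (`RCPeierls`);
* `rho_shift`, `K_shift` — translation invariance (`RCShift`, `Zrc_shift`), with the action `rcShift`;
* `card_withSupp_rcModel_le` — the contour count `Kc = 4^{3^d}`.

Consequences (the *output* of the analysis, Friedli–Velenik Prop. 7.34 pointwise / Grimmett Thm. (7.42) with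
(7.62)): in the `StableRegime` (τ(q) large), some phase has zero excess (`exists_excess_eq_zero'`), the phase whose
ground weight dominates by `2e^{-(2d+1)}` in logarithm has zero excess (`excess_eq_zero_of_log_le'`), in a phase of
zero excess every contour of that type has `K(γ) ≤ e^{-(τ(q) - 4^{d+2})|γ̄|}` (`K_le_exp`), and the total weight of
the configurations having a given external contour is at most `K(γ₀) Z^σ(V)` (`sum_wt_filter_le_K_mul`, FV
Lemma 7.26 / Grimmett's Peierls estimate Thm. (7.32)).

Everything is proved; no named facts.

## References

* S. Friedli, Y. Velenik, *Statistical Mechanics of Lattice Systems*, CUP 2017, §7.3 (eqs. (7.27)–(7.35),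
  Lemma 7.26), §7.4 (Thm. 7.29, Prop. 7.34). [FriedliVelenik2017]
* G. Grimmett, *The Random-Cluster Model*, Springer 2006, §7.5, Thm. (7.32), Thm. (7.42) with (7.44), (7.55),
  (7.62), (7.65)–(7.66). [Grimmett2006]
-/

noncomputable section

open Finset Relation

namespace Literature.Probability.LatticeModels

namespace RCC

open ContourSetup ClassCount ContourModel

variable {d : ℕ}

/-! ### The model -/

/-- **The local weight of a random-cluster contour**: `ρ(γ) = t^{e(γ)} q^{cwt(γ)} / w_{type γ}^{|γ̄|}`, the weight of the
support normalised by the ground weight of its type. [cite: FriedliVelenik2017, §7.3, eq. (7.30); Grimmett2006, §7.5, eq. (7.66)] -/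
def rho (d : ℕ) (t q : ℝ) (γ : (rcSetup d).Γ) : ℝ := t ^ γ.1.energy * q ^ γ.1.cwt / groundW d t q γ.1.type ^ (rcSetup d).size γ

/-- The partition functions are positive (`t, q > 0`). [cite: Grimmett2006, §1.2] -/
theorem Zrc_pos {t q : ℝ} (ht : 0 < t) (hq : 0 < q) (σ : Phase) (V : Finset (Site d)) : 0 < Zrc t q σ V :=
  sum_pos (fun _ _ => mul_pos (pow_pos ht _) (pow_pos hq _)) ⟨∅, empty_mem_powerset _⟩

/-- **The two-phase contour model of the random-cluster model on `ℤ^d`** in the variables `t = (p/(1-p))^{1/2}`,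
`q`: well-formed thick contours, local weights `ρ`, ground weights `t^{2d}` (`ord`) and `q` (`dis`) per site,
partition functions `Zrc`. [cite: FriedliVelenik2017, §7.3; Grimmett2006, §7.5] -/
def rcModel (d : ℕ) {t q : ℝ} (ht : 0 < t) (hq : 0 < q) : ContourModel d where
  toContourSetup := rcSetup d
  ρ := rho d t q
  w := groundW d t q
  Z := fun σ V => Zrc t q σ V
  ρ_nonneg := fun _ => div_nonneg (mul_nonneg (pow_nonneg ht.le _) (pow_nonneg hq.le _)) (pow_nonneg (groundW_pos ht hq _).le _)
  w_pos := groundW_pos ht hq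
  Z_pos := Zrc_pos ht hq

section Model

variable (hd : 2 ≤ d) {t q : ℝ} (ht : 0 < t) (hq : 0 < q)

/-- The contour setup of the model. [folklore] -/
theorem rcModel_toContourSetup : (rcModel d ht hq).toContourSetup = rcSetup d := rfl

include hd in
/-- **The external-contour representation holds for the random-cluster contour model** (FV (7.29)–(7.30)):
`Z^σ(V) = w_σ^{|V|} Σ_{Γ ∈ ExtFam σ V} Π_{γ ∈ Γ} G(γ)` for every finite `V` with `★`-connected complement.
[cite: FriedliVelenik2017, §7.3, eqs. (7.29)–(7.30); Grimmett2006, §7.5, eqs. (7.21)–(7.22)] -/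
theorem rcModel_rec : (rcModel d ht hq).Rec := by
  refine ⟨fun σ V hV => ?_⟩
  change Zrc t q σ V = groundW d t q σ ^ #V * ∑ Γ ∈ (rcSetup d).ExtFam σ V, ∏ γ ∈ Γ,
    (rho d t q γ * ∏ A ∈ (rcSetup d).ints γ, Zrc t q ((rcSetup d).lab γ A) A / groundW d t q ((rcSetup d).type γ) ^ #A)
  rw [Zrc_eq_sum_extFam hd hV, mul_sum]
  refine sum_congr rfl fun Γ hΓ => ?_
  set w := groundW d t q σ with hw
  have hw0 : w ≠ 0 := (groundW_pos ht hq σ).ne'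
  have hcard := ContourModel.card_eq_card_Wvol_add (M := rcModel d ht hq) hd hV hΓ
  change #V = #((rcSetup d).Wvol V Γ) + ∑ γ ∈ Γ, ((rcSetup d).size γ + #((rcSetup d).intr γ)) at hcard
  have hterm : ∀ γ ∈ Γ, rho d t q γ * ∏ A ∈ (rcSetup d).ints γ, Zrc t q ((rcSetup d).lab γ A) A / groundW d t q ((rcSetup d).type γ) ^ #A =
      (t ^ γ.1.energy * q ^ γ.1.cwt * ∏ A ∈ (rcSetup d).ints γ, Zrc t q ((rcSetup d).lab γ A) A) *
        (w ^ ((rcSetup d).size γ + #((rcSetup d).intr γ)))⁻¹ := by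
    intro γ hγ
    have hσ : γ.1.type = σ := type_eq_of_mem' hΓ hγ
    have hσ' : (rcSetup d).type γ = σ := type_eq_of_mem hΓ hγ
    have hints := ContourModel.sum_card_ints_eq (M := rcModel d ht hq) hd γ
    change ∑ A ∈ (rcSetup d).ints γ, #A = #((rcSetup d).intr γ) at hints
    rw [rho, hσ, hσ', ← hw, prod_div_distrib, prod_pow_eq_pow_sum, hints, pow_add]
    field_simp
  have hR : ∏ γ ∈ Γ, ((t ^ γ.1.energy * q ^ γ.1.cwt * ∏ A ∈ (rcSetup d).ints γ, Zrc t q ((rcSetup d).lab γ A) A) *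
        (w ^ ((rcSetup d).size γ + #((rcSetup d).intr γ)))⁻¹) =
      (∏ γ ∈ Γ, (t ^ γ.1.energy * q ^ γ.1.cwt * ∏ A ∈ (rcSetup d).ints γ, Zrc t q ((rcSetup d).lab γ A) A)) *
        (w ^ ∑ γ ∈ Γ, ((rcSetup d).size γ + #((rcSetup d).intr γ)))⁻¹ := by
    rw [prod_mul_distrib, prod_inv_distrib, prod_pow_eq_pow_sum]
  rw [prod_congr rfl hterm, hR, hcard, pow_add]
  field_simp

include hd ht in
/-- **The Peierls bound for the local weights** in the window `|2d log t - log q| ≤ 1`, `q ≥ 1`: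
`ρ(γ) ≤ e^{-τ(q)|γ̄|}` with `τ(q) = rcPeierlsRate d q`. [cite: Grimmett2006, §7.5, Thm. (7.42), eq. (7.55); FriedliVelenik2017, §7.4.2, eq. (7.52)] -/
theorem rho_le_exp (hq1 : 1 ≤ q) (hwin : |2 * d * Real.log t - Real.log q| ≤ 1) (γ : (rcSetup d).Γ) :
    rho d t q γ ≤ Real.exp (-rcPeierlsRate d q * (rcSetup d).size γ) := by
  rw [rho, div_le_iff₀ (pow_pos (groundW_pos ht (one_pos.trans_le hq1) _) _), groundW]
  split_ifs
  · exact peierls_weight_ord hd γ ht hq1 hwin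
  · exact peierls_weight_dis hd γ ht hq1 hwin

/-- The local weights are translation invariant. [cite: FriedliVelenik2017, §7.4.2] -/
theorem rho_shift (v : Site d) (γ : (rcSetup d).Γ) : rho d t q ((rcShift hd).shift v γ) = rho d t q γ := by
  have hs : (rcSetup d).size ((rcShift hd).shift v γ) = (rcSetup d).size γ := by
    show #(((rcShift hd).shift v γ).1.supp) = #γ.1.supp
    rw [rcShift_val, Contour.shift_supp, card_shiftSet]
  rw [rho, rho, energy_rcShift, cwt_rcShift, type_rcShift, hs]

/-- **The Pirogov–Sinai weights `K` are translation invariant.** [cite: FriedliVelenik2017, §7.4.2] -/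
theorem K_shift (v : Site d) (γ : (rcSetup d).Γ) : (rcModel d ht hq).K ((rcShift hd).shift v γ) = (rcModel d ht hq).K γ := by
  change rho d t q ((rcShift hd).shift v γ) * ∏ A ∈ (rcSetup d).ints ((rcShift hd).shift v γ),
      Zrc t q ((rcSetup d).lab ((rcShift hd).shift v γ) A) A / Zrc t q ((rcSetup d).type ((rcShift hd).shift v γ)) A =
    rho d t q γ * ∏ A ∈ (rcSetup d).ints γ, Zrc t q ((rcSetup d).lab γ A) A / Zrc t q ((rcSetup d).type γ) A
  rw [rho_shift, ints_rcShift, prod_image fun _ _ _ _ h => shiftSet_injective v h, (rcShift hd).type_shift]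
  refine congrArg _ (prod_congr rfl fun A _ => ?_)
  rw [lab_rcShift, Zrc_shift, Zrc_shift]

/-- At most `(4^{3^d})^{|A|}` contours of the model have support `A`. [cite: FriedliVelenik2017, §7.3 (counting contours)] -/
theorem card_withSupp_rcModel_le (A : Finset (Site d)) : #((rcModel d ht hq).withSupp A) ≤ (4 ^ 3 ^ d) ^ #A :=
  card_withSupp_rcSetup_le A

/-! ### The output of the Pirogov–Sinai analysis for the random-cluster model -/

/-- **The stability threshold**: `τ(q)` large enough for the engine of `PSStabilityInduction` with the contour
count `Kc = 4^{3^d}`. [cite: FriedliVelenik2017, §7.4.3, Prop. 7.34 (τ ≥ τ₁)] -/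
def StableRegime (d : ℕ) (q : ℝ) : Prop :=
  ((4 ^ 3 ^ d : ℕ) : ℝ) * (2 ^ (d + 1) * 9 ^ d) * Real.exp ((2 * d + 2) * 2 ^ d - (rcPeierlsRate d q - 4 ^ (d + 2))) ≤ 1

include hd in
/-- **The dichotomy engine, random-cluster form.** In the window `|2d log t - log q| ≤ 1`, `q ≥ 1`, in the stable
regime: in a phase `σ` of zero excess every contour of type `σ` obeys `K(γ) ≤ e^{-(τ(q) - 4^{d+2})|γ̄|}`.
[cite: FriedliVelenik2017, §7.4.3, Prop. 7.34, eqs. (7.65)–(7.66)] -/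
theorem K_le_exp (hq1 : 1 ≤ q) (hwin : |2 * d * Real.log t - Real.log q| ≤ 1) (hreg : StableRegime d q)
    {σ : Phase} (hσ : (rcModel d ht hq).excess (rcPeierlsRate d q - 4 ^ (d + 2)) σ = 0) {γ : (rcSetup d).Γ} (hγ : γ.1.type = σ) :
    (rcModel d ht hq).K γ ≤ Real.exp (-(rcPeierlsRate d q - 4 ^ (d + 2)) * (rcSetup d).size γ) :=
  K_le_exp_of_excess_eq_zero (M := rcModel d ht hq) hd (rcModel_rec hd ht hq) (rcShift hd) (rho_le_exp hd ht hq1 hwin)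
    (rho_shift hd) (K_shift hd ht hq) (card_withSupp_rcModel_le ht hq) hreg hσ hγ

/-- **Some phase has zero excess.** [cite: FriedliVelenik2017, §7.4.3 (min_# a_# = 0)] -/
theorem exists_excess_eq_zero' (τh : ℝ) : ∃ σ, (rcModel d ht hq).excess τh σ = 0 := ContourModel.exists_excess_eq_zero τh

include hd in
/-- **The dominant ground weight has zero excess** (stable regime): if
`log w_{σ'} + 2e^{-(2d+1)} ≤ log w_σ` for the other phase `σ'`, then `a_σ = 0`.
[cite: FriedliVelenik2017, §7.4.1 (𝒰^#) with Thm. 7.29] -/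
theorem excess_eq_zero_of_log_le' (hreg : StableRegime d q) {σ : Phase}
    (hw : Real.log (groundW d t q σ.other) + 2 * Real.exp (-(2 * d + 1)) ≤ Real.log (groundW d t q σ)) :
    (rcModel d ht hq).excess (rcPeierlsRate d q - 4 ^ (d + 2)) σ = 0 :=
  excess_eq_zero_of_log_le (M := rcModel d ht hq) (rcShift hd) (K_shift hd ht hq) (card_withSupp_rcModel_le ht hq) hreg hw

include hd in
/-- **The weight of the configurations having a given external contour is at most `K(γ₀) Z^σ(V)`**
(FV Lemma 7.26 for the random-cluster model): for `γ₀` of type `σ` in `V` (`★`-connected complement),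
`Σ_{ω : γ₀ ∈ extContours ω} wt(ω) ≤ K(γ₀) Z^σ(V)`. [cite: FriedliVelenik2017, §7.3.2, Lemma 7.26] -/
theorem sum_wt_filter_le_K_mul {σ : Phase} {V : Finset (Site d)} (hV : StarConn (V : Set (Site d))ᶜ)
    {γ₀ : (rcSetup d).Γ} (h₀ : γ₀ ∈ (rcSetup d).contoursIn σ V) :
    ∑ ω ∈ (freeEdges V).powerset with γ₀ ∈ xc σ V ω, wt t q σ V ω ≤ (rcModel d ht hq).K γ₀ * Zrc t q σ V := by
  have h := extFam_through_le (M := rcModel d ht hq) hd (rcModel_rec hd ht hq) hV h₀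
  have hrec := (rcModel_rec hd ht hq).eq σ V hV
  -- the left side of Lemma 7.26 is the filtered fibre sum
  rw [sum_wt_filter_mem_xc hd hV]
  refine le_trans (le_of_eq ?_) h
  change ∑ Γ ∈ ((rcSetup d).ExtFam σ V).filter (fun Γ => γ₀ ∈ Γ), groundW d t q σ ^ #((rcSetup d).Wvol V Γ) *
      ∏ γ ∈ Γ, (t ^ γ.1.energy * q ^ γ.1.cwt * ∏ A ∈ (rcSetup d).ints γ, Zrc t q ((rcSetup d).lab γ A) A) =
    groundW d t q σ ^ #V * ∑ Γ ∈ ((rcSetup d).ExtFam σ V).filter (fun Γ => γ₀ ∈ Γ), ∏ γ ∈ Γ,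
      (rho d t q γ * ∏ A ∈ (rcSetup d).ints γ, Zrc t q ((rcSetup d).lab γ A) A / groundW d t q ((rcSetup d).type γ) ^ #A)
  rw [mul_sum]
  refine sum_congr rfl fun Γ hΓ' => ?_
  obtain ⟨hΓ, -⟩ := mem_filter.1 hΓ'
  -- the same algebra as in `rcModel_rec`
  set w := groundW d t q σ with hw
  have hw0 : w ≠ 0 := (groundW_pos ht hq σ).ne'
  have hcard := ContourModel.card_eq_card_Wvol_add (M := rcModel d ht hq) hd hV hΓ
  change #V = #((rcSetup d).Wvol V Γ) + ∑ γ ∈ Γ, ((rcSetup d).size γ + #((rcSetup d).intr γ)) at hcard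
  have hterm : ∀ γ ∈ Γ, rho d t q γ * ∏ A ∈ (rcSetup d).ints γ, Zrc t q ((rcSetup d).lab γ A) A / groundW d t q ((rcSetup d).type γ) ^ #A =
      (t ^ γ.1.energy * q ^ γ.1.cwt * ∏ A ∈ (rcSetup d).ints γ, Zrc t q ((rcSetup d).lab γ A) A) *
        (w ^ ((rcSetup d).size γ + #((rcSetup d).intr γ)))⁻¹ := by
    intro γ hγ
    have hσ : γ.1.type = σ := type_eq_of_mem' hΓ hγ
    have hσ' : (rcSetup d).type γ = σ := type_eq_of_mem hΓ hγ
    have hints := ContourModel.sum_card_ints_eq (M := rcModel d ht hq) hd γ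
    change ∑ A ∈ (rcSetup d).ints γ, #A = #((rcSetup d).intr γ) at hints
    rw [rho, hσ, hσ', ← hw, prod_div_distrib, prod_pow_eq_pow_sum, hints, pow_add]
    field_simp
  have hR : ∏ γ ∈ Γ, ((t ^ γ.1.energy * q ^ γ.1.cwt * ∏ A ∈ (rcSetup d).ints γ, Zrc t q ((rcSetup d).lab γ A) A) *
        (w ^ ((rcSetup d).size γ + #((rcSetup d).intr γ)))⁻¹) =
      (∏ γ ∈ Γ, (t ^ γ.1.energy * q ^ γ.1.cwt * ∏ A ∈ (rcSetup d).ints γ, Zrc t q ((rcSetup d).lab γ A) A)) *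
        (w ^ ∑ γ ∈ Γ, ((rcSetup d).size γ + #((rcSetup d).intr γ)))⁻¹ := by
    rw [prod_mul_distrib, prod_inv_distrib, prod_pow_eq_pow_sum]
  rw [prod_congr rfl hterm, hR, hcard, pow_add]
  field_simp

include hd in
/-- **Peierls bound for the probability of an external contour**: `Σ_{ω : γ₀ external} wt(ω) / Z^σ(V) ≤ K(γ₀)`.
[cite: FriedliVelenik2017, §7.3.2, Lemma 7.26; Grimmett2006, Thm. (7.32) (Peierls estimate)] -/
theorem sum_wt_filter_div_le_K {σ : Phase} {V : Finset (Site d)} (hV : StarConn (V : Set (Site d))ᶜ)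
    {γ₀ : (rcSetup d).Γ} (h₀ : γ₀ ∈ (rcSetup d).contoursIn σ V) :
    (∑ ω ∈ (freeEdges V).powerset with γ₀ ∈ xc σ V ω, wt t q σ V ω) / Zrc t q σ V ≤ (rcModel d ht hq).K γ₀ := by
  rw [div_le_iff₀ (Zrc_pos ht hq σ V)]
  exact sum_wt_filter_le_K_mul hd ht hq hV h₀

end Model

end RCC

end Literature.Probability.LatticeModels
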